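import Summits.CriticalPhenomena.PercolationContinuityZ3.Theorems.PercNearOneGluingNoHeavyLowerTailThresholdRABFibres
import Summits.CriticalPhenomena.PercolationContinuityZ3.Theorems.PercNearOneGluingNoHeavyLowerTailThresholdTwoCount

/-!
# `NoHeavyLowerTail` (crux stmt-CriticalPhenomena-4575), lane prim-ineq-gen-4 (gen 18): three-partition positivity for EVERY threshold slot
# `Θ_k` in large dimension — the counting form (memo PROOFS-RAB-ALL-K-g18.md Theorem 3, integer variant §8b)

Support file (`--supports stmt-CriticalPhenomena-4575`).  No definitions, no `sorry`, standard axioms.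

THE STATEMENT (`threshold_counting`).  For proper up-sets `V, W` of finsets of a finite type `α` and `k ≥ 1`, the pair counts of the
three-partition functional with first slot `Θ_k = {T : k ≤ #T}` satisfy
  `dee(V, Θ_k ∩ W) + dee(W, Θ_k ∩ V) + dee(Θ_k, V ∩ W) ≤ 2·top(Θ_k ∩ V ∩ W) + tee(Θ_k, V, W)`
(i.e. `N(Θ_k,V,W) ≥ 0`, companion file `…ThresholdRABThreePartition`), PROVIDED the explicit counting condition `COND(α,k)`:
for every finset `u` with `1 ≤ #u < k`,
  `#{u' : 1 ≤ #u' < k} · #{Y ⊇ u : #Y + 3 ≤ 2k, k ≤ #Yᶜ} ≤ #{Y ⊇ u : 2k ≤ #Y + 1, k ≤ #Yᶜ}`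
(a condition on `(card α, k)` only; it holds for all `card α ≥ n₀''(k)` with `n₀''(k) = O(k)`, memo §8b — the "tiny" fibres through a
small set are polynomially many, the "big" ones exponentially many).

THE PROOF = the natural spectator certificate of gen 17 §0(E), assembled in integers: regroup the five pair counts over the fibre
`Y` (`card_crossPairs_eq_sum`, `card_diagPairs_eq_sum` of `…ThresholdTwoCount`); on each fibre use the fibre lemmas of `…ThresholdRABFibres`
(graded Kleitman when `#Yᶜ < k`; (RAB_k) when `2k ≤ #Y + 2`; its strict form, worth `+1`, when moreover `2k ≤ #Y + 1` and a small
common set lies in `Y`; the trivial bound with deficit `s_Y = #{small common sets in Y}` on the tiny fibres `#Y + 3 ≤ 2k`); finally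
double-count: the strict units on the big fibres pay for the tiny deficits because of `COND`.
-/

namespace Summit.CriticalPhenomena.PercolationContinuityZ3.Theorems.ThresholdRAB

open Finset

variable {α : Type*} [DecidableEq α] [Fintype α]

omit [Fintype α] in
/-- For `z ⊆ Y`: `k ≤ #(Y \ z) ↔ #z + k ≤ #Y`, as an equality of the two cross filters. [folklore] -/
theorem cross_cofilter_eq (V W : Finset (Finset α)) (Y : Finset α) (k : ℕ) :
    (Y.powerset.filter fun z => (z ∈ W ∧ Y \ z ∈ V) ∧ k ≤ #(Y \ z))
      = Y.powerset.filter fun z => (z ∈ W ∧ Y \ z ∈ V) ∧ #z + k ≤ #Y := by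
  ext z; simp only [mem_filter, mem_powerset]
  constructor
  · rintro ⟨h1, h2, h3⟩; rw [card_sdiff_of_subset h1] at h3; have := card_le_card h1; exact ⟨h1, h2, by omega⟩
  · rintro ⟨h1, h2, h3⟩; rw [card_sdiff_of_subset h1]; exact ⟨h1, h2, by omega⟩

/-- For `z ⊆ Y`: `((Y \ z) ∪ z)ᶜ = Yᶜ`, inside the tee filter. [folklore] -/
theorem tee_filter_eq (V W : Finset (Finset α)) (Y : Finset α) (k : ℕ) :
    (Y.powerset.filter fun z => (z ∈ W ∧ Y \ z ∈ V) ∧ k ≤ #((Y \ z) ∪ z)ᶜ)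
      = Y.powerset.filter fun z => (z ∈ W ∧ Y \ z ∈ V) ∧ k ≤ #Yᶜ := by
  ext z; simp only [mem_filter, mem_powerset]
  constructor
  · rintro ⟨h1, h2, h3⟩; rw [sdiff_union_of_subset h1] at h3; exact ⟨h1, h2, h3⟩
  · rintro ⟨h1, h2, h3⟩; rw [sdiff_union_of_subset h1]; exact ⟨h1, h2, h3⟩

/-- **Per-fibre bound of the natural certificate** (all classes of fibres at once).  With the trace counts of `…ThresholdRABFibres`,
`s_Y = #{u ⊆ Y : u ∈ W∩V, #u < k}`, the strict unit `ind_Y = [2k ≤ #Y + 1 ∧ k ≤ #Yᶜ ∧ 1 ≤ s_Y]` and the tiny deficit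
`def_Y = [#Y + 3 ≤ 2k ∧ k ≤ #Yᶜ]·s_Y`:
`x_Y + x'_Y + [k ≤ #Yᶜ]·d_Y + ind_Y ≤ 2 a_Y + [k ≤ #Yᶜ]·c_Y + def_Y`. [this work] -/
theorem fibre_bound (V W : Finset (Finset α)) (hV : IsUpperSet (V : Set (Finset α))) (hW : IsUpperSet (W : Set (Finset α)))
    (hV0 : ∅ ∉ V) (k : ℕ) (Y : Finset α) :
    #(Y.powerset.filter fun z => (z ∈ W ∧ Y \ z ∈ V) ∧ k ≤ #z)
        + #(Y.powerset.filter fun z => (z ∈ W ∧ Y \ z ∈ V) ∧ k ≤ #(Y \ z))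
        + #(Y.powerset.filter fun u => (u ∈ W ∧ u ∈ V) ∧ k ≤ #Yᶜ)
        + (if 2 * k ≤ #Y + 1 ∧ k ≤ #Yᶜ ∧ 1 ≤ #(Y.powerset.filter fun u => (u ∈ W ∧ u ∈ V) ∧ #u < k) then 1 else 0)
      ≤ 2 * #(Y.powerset.filter fun u => (u ∈ W ∧ u ∈ V) ∧ k ≤ #u)
        + #(Y.powerset.filter fun z => (z ∈ W ∧ Y \ z ∈ V) ∧ k ≤ #Yᶜ)
        + (if #Y + 3 ≤ 2 * k ∧ k ≤ #Yᶜ then #(Y.powerset.filter fun u => (u ∈ W ∧ u ∈ V) ∧ #u < k) else 0) := by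
  have hx := cross_filter_le_diag V W hV hW Y k
  have hx' := cross_cofilter_le_diag V W hV hW Y k
  by_cases hσ : k ≤ #Yᶜ
  · -- `σ ≥ k`: the two `[k ≤ #Yᶜ]` filters are the full diagonal / cross counts
    have ed : (Y.powerset.filter fun u => (u ∈ W ∧ u ∈ V) ∧ k ≤ #Yᶜ) = Y.powerset.filter fun u => u ∈ W ∧ u ∈ V := by
      ext u; simp only [mem_filter]; tauto
    have ec : (Y.powerset.filter fun z => (z ∈ W ∧ Y \ z ∈ V) ∧ k ≤ #Yᶜ) = Y.powerset.filter fun z => z ∈ W ∧ Y \ z ∈ V := by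
      ext z; simp only [mem_filter]; tauto
    rw [ed, ec]
    -- d = a + s
    have hd : #(Y.powerset.filter fun u => u ∈ W ∧ u ∈ V)
        = #(Y.powerset.filter fun u => (u ∈ W ∧ u ∈ V) ∧ k ≤ #u) + #(Y.powerset.filter fun u => (u ∈ W ∧ u ∈ V) ∧ #u < k) := by
      rw [← card_union_of_disjoint]
      · congr 1; ext u; simp only [mem_filter, mem_union]
        constructor
        · intro h
          by_cases hku : k ≤ #u
          · exact Or.inl ⟨h.1, h.2, hku⟩
          · exact Or.inr ⟨h.1, h.2, by omega⟩
        · rintro (h | h)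
          · exact ⟨h.1, h.2.1⟩
          · exact ⟨h.1, h.2.1⟩
      · rw [disjoint_left]; intro u h1 h2; rw [mem_filter] at h1 h2; omega
    rw [hd]
    by_cases htiny : #Y + 3 ≤ 2 * k
    · -- tiny fibre: deficit `s_Y`
      have hc1 : ¬ (2 * k ≤ #Y + 1 ∧ k ≤ #Yᶜ ∧ 1 ≤ #(Y.powerset.filter fun u => (u ∈ W ∧ u ∈ V) ∧ #u < k)) := by
        rintro ⟨h, -⟩; omega
      have hc2 : #Y + 3 ≤ 2 * k ∧ k ≤ #Yᶜ := ⟨htiny, hσ⟩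
      rw [if_neg hc1, if_pos hc2]
      have h := cross_filter_add_cofilter_le V W Y k (by omega)
      omega
    · have hc2 : ¬ (#Y + 3 ≤ 2 * k ∧ k ≤ #Yᶜ) := fun h => htiny h.1
      rw [if_neg hc2]
      have hrab := fibre_rab V W hV hW Y k (by omega)
      rw [← cross_cofilter_eq] at hrab
      by_cases hind : 2 * k ≤ #Y + 1 ∧ k ≤ #Yᶜ ∧ 1 ≤ #(Y.powerset.filter fun u => (u ∈ W ∧ u ∈ V) ∧ #u < k)
      · rw [if_pos hind]
        obtain ⟨u₀, hu₀⟩ := card_pos.1 (by have := hind.2.2; omega :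
          0 < #(Y.powerset.filter fun u => (u ∈ W ∧ u ∈ V) ∧ #u < k))
        rw [mem_filter, mem_powerset] at hu₀
        have hstr := fibre_rab_strict V W hV hW hV0 Y k hind.1 hu₀.1 hu₀.2.1.1 hu₀.2.1.2 hu₀.2.2
        rw [← cross_cofilter_eq] at hstr
        omega
      · rw [if_neg hind]
        omega
  · -- `σ < k`: only the two graded Kleitman inequalities
    have ed : (Y.powerset.filter fun u => (u ∈ W ∧ u ∈ V) ∧ k ≤ #Yᶜ) = ∅ := by
      rw [filter_eq_empty_iff]; intro u _ h; exact hσ h.2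
    have ec : (Y.powerset.filter fun z => (z ∈ W ∧ Y \ z ∈ V) ∧ k ≤ #Yᶜ) = ∅ := by
      rw [filter_eq_empty_iff]; intro z _ h; exact hσ h.2
    have hc1 : ¬ (2 * k ≤ #Y + 1 ∧ k ≤ #Yᶜ ∧ 1 ≤ #(Y.powerset.filter fun u => (u ∈ W ∧ u ∈ V) ∧ #u < k)) :=
      fun h => hσ h.2.1
    have hc2 : ¬ (#Y + 3 ≤ 2 * k ∧ k ≤ #Yᶜ) := fun h => hσ h.2
    rw [ed, ec, card_empty, if_neg hc1, if_neg hc2]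
    omega

/-- Double counting of the small common sets over a class of fibres `P`:
`Σ_Y [P Y]·s_Y = Σ_{u small common} #{Y : P Y, u ⊆ Y}`. [this work] -/
theorem sum_smallSets_eq (V W : Finset (Finset α)) (k : ℕ) (P : Finset α → Prop) [DecidablePred P] :
    ∑ Y : Finset α, (if P Y then #(Y.powerset.filter fun u => (u ∈ W ∧ u ∈ V) ∧ #u < k) else 0)
      = ∑ u ∈ (univ : Finset (Finset α)).filter (fun u => (u ∈ W ∧ u ∈ V) ∧ #u < k),
          #((univ : Finset (Finset α)).filter fun Y => P Y ∧ u ⊆ Y) := by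
  have h1 : ∀ Y : Finset α, (if P Y then #(Y.powerset.filter fun u => (u ∈ W ∧ u ∈ V) ∧ #u < k) else 0)
      = ∑ u ∈ (univ : Finset (Finset α)).filter (fun u => (u ∈ W ∧ u ∈ V) ∧ #u < k), (if P Y ∧ u ⊆ Y then 1 else 0) := by
    intro Y
    by_cases hP : P Y
    · simp only [hP, true_and, if_true]
      rw [sum_boole, Nat.cast_id]
      congr 1; ext u; simp only [mem_filter, mem_powerset, mem_univ, true_and]; tauto
    · simp [hP]
  rw [sum_congr rfl fun Y _ => h1 Y, sum_comm]
  refine sum_congr rfl fun u _ => ?_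
  rw [sum_boole, Nat.cast_id]

/-- **Counting form of three-partition positivity for the threshold slot `Θ_k`** under the counting condition `COND(α,k)`
(memo Theorem 3, integer variant §8b).  For proper up-sets `V, W` and `k ≥ 1`:
`#{(v,w) cross : k ≤ #w} + #{(v,w) cross : k ≤ #v} + #{(u,s) diag : k ≤ #s} ≤ 2·#{(u,s) diag : k ≤ #u} + #{(v,w) cross : k ≤ #(v∪w)ᶜ}`,
where "cross" = `v ∈ V, w ∈ W, v ∩ w = ∅` and "diag" = `u ∈ V ∩ W, u ∩ s = ∅`. [this work] -/
theorem threshold_counting (V W : Finset (Finset α)) (hV : IsUpperSet (V : Set (Finset α)))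
    (hW : IsUpperSet (W : Set (Finset α))) (hV0 : ∅ ∉ V) (k : ℕ)
    (hcond : ∀ u : Finset α, 1 ≤ #u → #u < k →
      #((univ : Finset (Finset α)).filter fun u' => 1 ≤ #u' ∧ #u' < k)
          * #((univ : Finset (Finset α)).filter fun Y => (#Y + 3 ≤ 2 * k ∧ k ≤ #Yᶜ) ∧ u ⊆ Y)
        ≤ #((univ : Finset (Finset α)).filter fun Y => (2 * k ≤ #Y + 1 ∧ k ≤ #Yᶜ) ∧ u ⊆ Y)) :
    #((univ : Finset (Finset α × Finset α)).filter fun q => (q.1 ∈ V ∧ q.2 ∈ W ∧ Disjoint q.1 q.2) ∧ k ≤ #q.2)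
      + #((univ : Finset (Finset α × Finset α)).filter fun q => (q.1 ∈ V ∧ q.2 ∈ W ∧ Disjoint q.1 q.2) ∧ k ≤ #q.1)
      + #((univ : Finset (Finset α × Finset α)).filter fun q => ((q.1 ∈ V ∧ q.1 ∈ W) ∧ Disjoint q.1 q.2) ∧ k ≤ #q.2)
    ≤ 2 * #((univ : Finset (Finset α × Finset α)).filter fun q => ((q.1 ∈ V ∧ q.1 ∈ W) ∧ Disjoint q.1 q.2) ∧ k ≤ #q.1)
      + #((univ : Finset (Finset α × Finset α)).filter fun q =>
          (q.1 ∈ V ∧ q.2 ∈ W ∧ Disjoint q.1 q.2) ∧ k ≤ #(q.1 ∪ q.2)ᶜ) := by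
  -- regroup over fibres
  rw [ThresholdTwoFibre.card_crossPairs_eq_sum V W (fun q => k ≤ #q.2),
    ThresholdTwoFibre.card_crossPairs_eq_sum V W (fun q => k ≤ #q.1),
    ThresholdTwoFibre.card_diagPairs_eq_sum V W (fun q => k ≤ #q.2),
    ThresholdTwoFibre.card_diagPairs_eq_sum V W (fun q => k ≤ #q.1),
    ThresholdTwoFibre.card_crossPairs_eq_sum V W (fun q => k ≤ #(q.1 ∪ q.2)ᶜ)]
  simp only []
  -- per-fibre bounds, summed
  have hfib := fun Y : Finset α => fibre_bound V W hV hW hV0 k Y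
  have hsum := sum_le_sum fun Y (_ : Y ∈ (univ : Finset (Finset α))) => hfib Y
  simp only [sum_add_distrib, ← mul_sum] at hsum
  rw [sum_congr rfl fun Y _ => congrArg Finset.card (tee_filter_eq V W Y k)]
  -- the strict units pay for the tiny deficits
  have hpay : ∑ Y : Finset α, (if #Y + 3 ≤ 2 * k ∧ k ≤ #Yᶜ then #(Y.powerset.filter fun u => (u ∈ W ∧ u ∈ V) ∧ #u < k) else 0)
      ≤ ∑ Y : Finset α, (if 2 * k ≤ #Y + 1 ∧ k ≤ #Yᶜ ∧ 1 ≤ #(Y.powerset.filter fun u => (u ∈ W ∧ u ∈ V) ∧ #u < k) then 1 else 0) := by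
    set S := #((univ : Finset (Finset α)).filter fun u' => 1 ≤ #u' ∧ #u' < k) with hS
    -- every s_Y is at most S
    have hsS : ∀ Y : Finset α, #(Y.powerset.filter fun u => (u ∈ W ∧ u ∈ V) ∧ #u < k) ≤ S := by
      intro Y; apply card_le_card; intro u hu
      rw [mem_filter, mem_powerset] at hu
      rw [mem_filter]
      refine ⟨mem_univ _, ?_, hu.2.2⟩
      rw [Nat.one_le_iff_ne_zero]; intro h0
      exact hV0 (card_eq_zero.1 h0 ▸ hu.2.1.2)
    -- S · (Σ ind) ≥ Σ_{big'} s_Y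
    have h1 : ∑ Y : Finset α, (if 2 * k ≤ #Y + 1 ∧ k ≤ #Yᶜ then #(Y.powerset.filter fun u => (u ∈ W ∧ u ∈ V) ∧ #u < k) else 0)
        ≤ S * ∑ Y : Finset α, (if 2 * k ≤ #Y + 1 ∧ k ≤ #Yᶜ ∧ 1 ≤ #(Y.powerset.filter fun u => (u ∈ W ∧ u ∈ V) ∧ #u < k)
            then 1 else 0) := by
      rw [mul_sum]
      refine sum_le_sum fun Y _ => ?_
      by_cases hb : 2 * k ≤ #Y + 1 ∧ k ≤ #Yᶜ
      · rw [if_pos hb]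
        by_cases hs : 1 ≤ #(Y.powerset.filter fun u => (u ∈ W ∧ u ∈ V) ∧ #u < k)
        · rw [if_pos ⟨hb.1, hb.2, hs⟩, mul_one]; exact hsS Y
        · rw [if_neg (by rintro ⟨-, -, h⟩; exact hs h)]; omega
      · rw [if_neg hb]; exact Nat.zero_le _
    -- double counting on both classes and COND
    have h2 : S * ∑ Y : Finset α, (if #Y + 3 ≤ 2 * k ∧ k ≤ #Yᶜ then #(Y.powerset.filter fun u => (u ∈ W ∧ u ∈ V) ∧ #u < k) else 0)
        ≤ ∑ Y : Finset α, (if 2 * k ≤ #Y + 1 ∧ k ≤ #Yᶜ then #(Y.powerset.filter fun u => (u ∈ W ∧ u ∈ V) ∧ #u < k) else 0) := by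
      rw [sum_smallSets_eq V W k (fun Y => #Y + 3 ≤ 2 * k ∧ k ≤ #Yᶜ), sum_smallSets_eq V W k (fun Y => 2 * k ≤ #Y + 1 ∧ k ≤ #Yᶜ),
        mul_sum]
      refine sum_le_sum fun u hu => ?_
      rw [mem_filter] at hu
      have hu1 : 1 ≤ #u := by
        rw [Nat.one_le_iff_ne_zero]; intro h0; exact hV0 (card_eq_zero.1 h0 ▸ hu.2.1.2)
      exact hcond u hu1 hu.2.2
    -- combine: if S = 0 there are no small sets at all
    rcases Nat.eq_zero_or_pos S with hS0 | hSpos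
    · have : ∀ Y : Finset α, #(Y.powerset.filter fun u => (u ∈ W ∧ u ∈ V) ∧ #u < k) = 0 := fun Y => by
        have := hsS Y; omega
      simp only [this]
      simp
    · have h3 := h2.trans h1
      exact le_of_mul_le_mul_left h3 hSpos
  omega

end Summit.CriticalPhenomena.PercolationContinuityZ3.Theorems.ThresholdRAB
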